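import Summits.Langlands.Langlands.Theorems.QuadraticWindowHostInducedRepPackageSign
import Summits.Langlands.Langlands.Theorems.QuadraticWindowHostInducedRepPaneDefs
import Literature.NumberTheory.QuadraticForms.QuadraticExtensionPlaces
/-!
# The sign step — sub-stub `stub_memberSign` of the member statement `pkg_member` (stub
# `stub_package`, line `one-transparent-pane`, crux `Summit.Langlands.Langlands.Theses.QuadraticWindow.HostInducedRep`,
# item stmt-Langlands-10902)

LOG (wave-2 worker `pkg_member`, 2026-08-16): PROVED, rc 0, 0 warnings, 0 sorries, standard axioms; the
registered signature follows `theorem stub_memberSign :` verbatim; predicates: `…HostInducedRepPaneDefs.lean`.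

Statement.  Hypotheses (inline): existence of Asai signs (`hex`), the sign pin (`hpin` = statement of
`stub_signPin`), the pane law (`hpane` = conclusion of `stub_paneLaw`); the crux data with `Hyps`, `F` not
totally real; a CM quadratic `K/F₀` (involution `cK`); a pane tower `L ⊃ F, K` with involution `s`
(`IsPaneTower`); `θ` with `ParityOut F K θ`; and for every admissible `μ` (`MuHyp`) member objects
`τ', ψ₁, P, T, χ` with `SatakeOut`, `ArchOut`, `PaneArchOut` for `χ₀ = θ⁻¹ μ`.  Conclusion: `MemberPkg`.

Proof (pure logic).  (A) For `μ = 1` an Asai sign `κ` of `P` exists; at every embedding `σ` of `L`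
complex on `F` (a pane: `IsConj σ s`) the pin with `r = (n-1)/2 + (m_σ+k)/2` and the coset clause give
`(-1)^{m_σ+k} = κ` (`neg_one_zpow_eq_of_pin`), so `θ_v(-1)` is constant on the complex-type real places
of `F₀`.  (B) `ParityOut`: constant below the real places of `F`; every real place is of one type
(`exists_isReal_of_not_cx`); switch `ε₀, c ∈ {±1}`.  (C) `μ ∈ {1, μK, μF, μK μF}` (signs `1`, `-1`,
`-1` exactly on the complex type) achieves `(θ⁻¹μ)_v(-1) = (-1)^{n+k}` everywhere.  (D) `ArchOut` gives
`C`-algebraicity and algebraicity of `ψ₁`; (E) at one pane (exists: `F` is not totally real)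
`PaneArchOut` gives exponents in `½ + ℤ` (`exists_int_add_half_of_parity`) and the pane law at the
base `K⁺ = maximalRealSubfield K` (`complexConj K = cK`, `complexConj_apply_eq`; transport of
`IsConjSelfDualAE`) gives `HasAsaiSign (complexConj K) 1`.
-/

open scoped BigOperators Polynomial Classical
open Filter Polynomial IsDedekindDomain NumberField
open Literature.NumberTheory.Automorphic Literature.NumberTheory.GaloisRepresentations
open Summit.Langlands.Langlands.Theorems.HostInducedRep.GrsExplicitDescent

-- `Summit.Langlands.Langlands.…` (summit = sub-problem name, D-0017 layout) trips `dupNamespace`.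
set_option linter.dupNamespace false

noncomputable section

namespace Summit.Langlands.Langlands.Theorems.HostInducedRep.OneTransparentPane

/-! ## §1 Arithmetic of signs and of the pin -/

section Arith

/-- `(-1)^a = (-1)^b` in `ℂ` iff `a` and `b` have the same parity. [folklore] -/
theorem neg_one_zpow_eq_iff (a b : ℤ) : (-1 : ℂ) ^ a = (-1 : ℂ) ^ b ↔ (Even a ↔ Even b) := by
  have h1 : (1 : ℂ) ≠ -1 := by norm_num
  rw [neg_one_zpow_eq_ite, neg_one_zpow_eq_ite]
  by_cases ha : Even a <;> by_cases hb : Even b <;> simp [ha, hb, h1, h1.symm]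

/-- **Pin arithmetic**: `j + (n-1)/2 + (m+k)/2 = j' + (n-1)/2 + (1-κ)/4` forces `(-1)^{m+k} = κ`. [folklore] -/
theorem neg_one_zpow_eq_of_pin {j j' m k : ℤ} {n : ℕ} {κ : ℤˣ}
    (h : (j : ℂ) + ((n : ℂ) - 1) / 2 + ((m : ℂ) + k) / 2 =
      (j' : ℂ) + ((n : ℂ) - 1) / 2 + (1 - ((κ : ℤ) : ℂ)) / 4) :
    (-1 : ℂ) ^ (m + k) = ((κ : ℤ) : ℂ) := by
  have h4 : ((4 * j + 2 * (m + k) : ℤ) : ℂ) = ((4 * j' + (1 - (κ : ℤ)) : ℤ) : ℂ) := by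
    push_cast
    linear_combination 4 * h
  have hint : 4 * j + 2 * (m + k) = 4 * j' + (1 - (κ : ℤ)) := by exact_mod_cast h4
  rcases Int.units_eq_one_or κ with rfl | rfl
  · have he : Even (m + k) := ⟨j' - j, by push_cast at hint; omega⟩
    rw [he.neg_one_zpow]; simp
  · have ho : Odd (m + k) := ⟨j' - j, by push_cast at hint; omega⟩
    rw [ho.neg_one_zpow]; simp

/-- If `(-1)^m = (-1)^{n+k}` then the coset `(n-1)/2 + (m+k)/2 + ℤ` is `½ + ℤ`. [folklore] -/
theorem exists_int_add_half_of_neg_one_zpow {m k : ℤ} {n : ℕ}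
    (h : (-1 : ℂ) ^ m = (-1 : ℂ) ^ ((n : ℤ) + k)) {a : ℂ} {j : ℤ}
    (ha : a = (j : ℂ) + ((n : ℂ) - 1) / 2 + ((m : ℂ) + k) / 2) : ∃ i : ℤ, a = (i : ℂ) + 1 / 2 := by
  have hpar : (m + k).negOnePow = (n : ℤ).negOnePow := by
    rw [Int.negOnePow_eq_iff]
    have h' := (neg_one_zpow_eq_iff _ _).mp h
    have e : m + k - (n : ℤ) = (m - ((n : ℤ) + k)) + 2 * k := by ring
    rw [e, Int.even_add, Int.even_sub]
    exact iff_of_true h' ⟨k, two_mul k⟩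
  obtain ⟨i, hi⟩ := exists_int_add_half_of_parity hpar (p := (j : ℂ) + ((n : ℂ) - 1) / 2) ⟨j, rfl⟩
  exact ⟨i, by rw [ha, ← hi]⟩

end Arith

/-! ## §2 Signs of Hecke characters at the real places -/

section Signs

variable {F₀ : Type} [Field F₀] [NumberField F₀]

/-- `ψ_v(-1)² = 1`. [folklore] -/
theorem archComponent_neg_one_sq (ψ : HeckeCharacter F₀) (v : InfinitePlace F₀) :
    ψ.archComponent v (-1) ^ 2 = 1 := by
  rw [sq, ← map_mul, neg_mul_neg, one_mul, map_one]

/-- A unit of `ℂ` with square `1` is `±1`. [folklore] -/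
theorem units_eq_or_of_sq {x : ℂˣ} (h : x ^ 2 = 1) : x = 1 ∨ x = -1 := by
  have h' : ((x : ℂˣ) : ℂ) ^ 2 = 1 := by rw [← Units.val_pow_eq_pow_val, h, Units.val_one]
  rcases sq_eq_one_iff.mp h' with h1 | h1
  · exact Or.inl (Units.ext h1)
  · exact Or.inr (Units.ext (by rw [h1, Units.val_neg, Units.val_one]))

/-- Real components are multiplicative in the character. [folklore] -/
theorem archComponent_mul_apply (ψ ψ' : HeckeCharacter F₀) (v : InfinitePlace F₀)
    (x : (v.Completion)ˣ) :
    (ψ * ψ').archComponent v x = ψ.archComponent v x * ψ'.archComponent v x := by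
  simp only [HeckeCharacter.archComponent_apply, HeckeCharacter.mul_apply]

/-- Real components of the inverse character. [folklore] -/
theorem archComponent_inv_apply (ψ : HeckeCharacter F₀) (v : InfinitePlace F₀) (x : (v.Completion)ˣ) :
    ψ⁻¹.archComponent v x = (ψ.archComponent v x)⁻¹ := by
  simp only [HeckeCharacter.archComponent_apply, HeckeCharacter.inv_apply]

end Signs

section CM -- §3 the CM involution: `complexConj K = cK`, transport of conjugate self-duality

open scoped Pointwise

variable {F₀ K : Type} [Field F₀] [NumberField F₀] [Field K] [NumberField K] [Algebra F₀ K]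

/-- **`complexConj K` is the involution `cK` of the CM quadratic `K/F₀`** (`F₀` totally real: the
conjugate of an embedding `φ` of `K` extends `φ|_{F₀}` and differs from `φ`). [folklore] -/
theorem complexConj_apply_eq [IsCMField K] (hTR : IsTotallyReal F₀) (h2 : Module.finrank F₀ K = 2)
    {cK : K ≃ₐ[F₀] K} (hcK : cK ≠ 1) (x : K) : IsCMField.complexConj K x = cK x := by
  haveI : Algebra.IsQuadraticExtension F₀ K := ⟨h2⟩
  haveI := hTR
  let φ : K →+* ℂ := Classical.choice inferInstance
  have hreal : (ComplexEmbedding.conjugate φ).comp (algebraMap F₀ K) = φ.comp (algebraMap F₀ K) :=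
    IsTotallyReal.complexEmbedding_isReal (φ.comp (algebraMap F₀ K))
  obtain ⟨σ₀, hσ₀⟩ :=
    ComplexEmbedding.exists_comp_symm_eq_of_comp_eq (k := F₀) (ComplexEmbedding.conjugate φ) φ hreal
  have hconj : ∀ y : K, φ (σ₀ y) = starRingEnd ℂ (φ y) := fun y ↦ by
    have h := RingHom.congr_fun hσ₀ (σ₀ y)
    change starRingEnd ℂ (φ (σ₀.symm (σ₀ y))) = φ (σ₀ y) at h
    rw [AlgEquiv.symm_apply_apply] at h
    exact h.symm
  have hne : σ₀ ≠ 1 := by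
    rintro rfl
    have hR : ComplexEmbedding.IsReal φ :=
      RingHom.ext fun y ↦ by rw [ComplexEmbedding.conjugate_coe_eq, ← hconj y, AlgEquiv.one_apply]
    exact IsTotallyComplex.complexEmbedding_not_isReal φ hR
  have hσ₀eq : σ₀ = cK := by
    rcases Literature.NumberTheory.QuadraticForms.QuadraticExtension.algEquiv_eq_one_or_eq hcK σ₀
      with h | h
    · exact absurd h hne
    · exact h
  have h1 : φ (cK x) = starRingEnd ℂ (φ x) := by rw [← hσ₀eq]; exact hconj x
  have h2' : φ (IsCMField.complexConj K x) = starRingEnd ℂ (φ x) :=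
    IsCMField.complexEmbedding_complexConj K φ x
  exact φ.injective (h2'.trans h1.symm)

/-- The place actions of `complexConj K` and `cK` agree. [folklore] -/
theorem complexConj_smul_eq [IsCMField K] (hTR : IsTotallyReal F₀) (h2 : Module.finrank F₀ K = 2)
    {cK : K ≃ₐ[F₀] K} (hcK : cK ≠ 1) (u : HeightOneSpectrum (𝓞 K)) :
    IsCMField.complexConj K • u = cK • u := by
  apply HeightOneSpectrum.ext
  rw [HeightOneSpectrum.smul_asIdeal, HeightOneSpectrum.smul_asIdeal, Ideal.pointwise_smul_def,
    Ideal.pointwise_smul_def]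
  congr 1
  refine RingHom.ext fun x ↦ RingOfIntegers.ext ?_
  change ((IsCMField.complexConj K • x : 𝓞 K) : K) = ((cK • x : 𝓞 K) : K)
  rw [RingOfIntegers.coe_algEquiv_smul, RingOfIntegers.coe_algEquiv_smul]
  exact complexConj_apply_eq hTR h2 hcK x

/-- Transport of a.e. conjugate self-duality along equal place actions. [folklore] -/
theorem isConjSelfDualAE_of_smul_eq {F₁ F₂ : Type} [Field F₁] [NumberField F₁] [Field F₂]
    [NumberField F₂] [Algebra F₁ K] [Algebra F₂ K] {c₁ : K ≃ₐ[F₁] K} {c₂ : K ≃ₐ[F₂] K}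
    (h : ∀ u : HeightOneSpectrum (𝓞 K), c₁ • u = c₂ • u) {N : ℕ}
    {hK : isCompact_glFiniteIntegralLevel N K} {P : AutomorphicRepData (AutomorphyDatum.gl N K hK)}
    (hP : P.IsConjSelfDualAE c₂) : P.IsConjSelfDualAE c₁ := by
  unfold AutomorphicRepData.IsConjSelfDualAE at hP ⊢
  simp_rw [h]
  exact hP

end CM

section Places -- §4 real places of `F₀` of split type; the trivial sign-twisting character

variable {F₀ F L : Type} [Field F₀] [NumberField F₀] [Field F] [NumberField F] [Algebra F₀ F]
  [Field L] [NumberField L] [Algebra F₀ L] [Algebra F L] [IsScalarTower F₀ F L]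

/-- A real place of `F₀` below no embedding of `L` complex on `F` lies below a REAL place of `F`. [folklore] -/
theorem exists_isReal_of_not_cx (v : InfinitePlace F₀)
    (h : ¬ ∃ σ : L →+* ℂ, ¬ ComplexEmbedding.IsReal (σ.comp (algebraMap F L)) ∧
      InfinitePlace.mk (σ.comp (algebraMap F₀ L)) = v) :
    ∃ w : InfinitePlace F, w.IsReal ∧ w.comap (algebraMap F₀ F) = v := by
  haveI : Algebra.IsAlgebraic F₀ F := Algebra.IsAlgebraic.of_finite F₀ F
  haveI : Algebra.IsAlgebraic F L := Algebra.IsAlgebraic.of_finite F L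
  obtain ⟨w, hw⟩ := InfinitePlace.comap_surjective (k := F₀) (K := F) v
  dsimp only at hw
  by_cases hreal : w.IsReal
  · exact ⟨w, hreal, hw⟩
  exfalso
  refine h ⟨ComplexEmbedding.lift L w.embedding, ?_, ?_⟩
  · rw [ComplexEmbedding.lift_comp_algebraMap]
    rwa [InfinitePlace.not_isReal_iff_isComplex, InfinitePlace.isComplex_iff] at hreal
  · rw [IsScalarTower.algebraMap_eq F₀ F L, ← RingHom.comp_assoc, ComplexEmbedding.lift_comp_algebraMap,
      ← InfinitePlace.comap_mk, InfinitePlace.mk_embedding, hw]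

omit [IsScalarTower F₀ F L] [Algebra F₀ L] [NumberField F] [NumberField L] in
/-- An embedding of `L` complex on `F` lies over a COMPLEX place of `F`. [folklore] -/
theorem not_isReal_mk_of_cx {σ : L →+* ℂ} (hσ : ¬ ComplexEmbedding.IsReal (σ.comp (algebraMap F L))) :
    ¬ (InfinitePlace.mk (σ.comp (algebraMap F L))).IsReal := by
  rwa [InfinitePlace.isReal_mk_iff]

end Places

section MuOne

variable {F₀ : Type} [Field F₀] [NumberField F₀]

/-- The trivial character is an admissible sign-twisting character. [folklore] -/
theorem muHyp_one (F K : Type) [Field F] [NumberField F] [Algebra F₀ F] [Field K] [NumberField K]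
    [Algebra F₀ K] : MuHyp F K (1 : HeckeCharacter F₀) := by
  refine ⟨IsOfFinOrder.one, Eventually.of_forall fun v ↦ ⟨fun u ↦ rfl, ?_, fun _ _ ↦ ?_⟩⟩ <;>
    simp [HeckeCharacter.valueAtUniformizer]

end MuOne

/-! ## §5 The sign step -/

section Main

/-- **Sub-stub SIGN (`stub_memberSign`, PROVED)** — the sign law of the line in typed form: from `hex`,
`hpin`, `hpane`, the parity output and the member outputs for every admissible `μ`, the member statement
`MemberPkg` (type I everywhere, standard Asai sign); proof in the module docstring. [folklore] -/
theorem stub_memberSign : (∀ (F E : Type) [Field F] [NumberField F] [Field E] [NumberField E] [Algebra F E] (c : E ≃ₐ[F] E), Module.finrank F E = 2 → c ≠ 1 → ∀ (N : ℕ) (hcpt : isCompact_glFiniteIntegralLevel N E) (P : CuspidalAutomorphicRepData N E hcpt), 0 < N → P.1.IsConjSelfDualAE c → ∃ κ : ℤˣ, P.1.HasAsaiSign c κ) → (∀ (F E : Type) [Field F] [NumberField F] [Field E] [NumberField E] [Algebra F E] (c : E ≃ₐ[F] E), Module.finrank F E = 2 → c ≠ 1 → ∀ (N : ℕ) (hcpt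 : isCompact_glFiniteIntegralLevel N E) (P : CuspidalAutomorphicRepData N E hcpt) (κ : ℤˣ) (χ : (E →+* ℂ) → Multiset ℂ) (σ : E →+* ℂ) (r : ℝ), 0 < N → P.1.IsConjSelfDualAE c → P.1.HasAsaiSign c κ → P.1.HasArchParameter χ → NumberField.ComplexEmbedding.IsConj σ c → (χ σ).Nodup → (∀ a ∈ χ σ, ∃ m : ℤ, a = (m : ℂ) + (r : ℂ)) → ∀ a ∈ χ σ, ∃ m : ℤ, a = (m : ℂ) + ((N : ℂ) - 1) / 2 + (1 - ((κ : ℤ) : ℂ)) / 4) → (∀ (F₀ K F' L : Type) [Field F₀] [NumberField F₀] [Field K] [NumberField K] [Field F'] [NumberField F'] [Field L] [NumberField L] [Algebra F₀ K] [Algebra K L] [Algebra F' L] (cK : K ≃ₐ[F₀] K) (s : L ≃ₐ[F'] L), Module.finrank F₀ K = 2 → Module.finrank K L = 2 → Module.finrank F' L = 2 → cK ≠ 1 → s ≠ 1 → (∀ x : K, s (algebraMap K L x) = algebraMap K L (cK x)) → ∀ (n : ℕ) (hL : isCompact_glFiniteIntegralLevel n L) (hK : isCompact_glFiniteIntegralLevel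 (2 * n) K) (P : CuspidalAutomorphicRepData n L hL) (Q : CuspidalAutomorphicRepData (2 * n) K hK) (χ : (L →+* ℂ) → Multiset ℂ) (σ : L →+* ℂ), 0 < n → IsAutomorphicInductionAlong P.1 Q.1 → P.1.IsConjSelfDualAE s → Q.1.IsConjSelfDualAE cK → P.1.HasArchParameter χ → NumberField.ComplexEmbedding.IsConj σ s → (χ σ).Nodup → Multiset.card (χ σ) = n → (∀ a ∈ χ σ, ∃ m : ℤ, a = (m : ℂ) + 1 / 2) → Q.1.HasAsaiSign cK 1) → ∀ (F₀ F : Type) [Field F₀] [NumberField F₀] [Field F] [NumberField F] [Algebra F₀ F] (τ : F ≃ₐ[F₀] F) (n : ℕ) (hcpt : isCompact_glFiniteIntegralLevel n F) (π : CuspidalAutomorphicRepData n F hcpt) (e : FramedGaloisRep F₀ ℂ 1) (k : ℤ) (ℓ : ℕ) [Fact ℓ.Prime] (ι : PadicAlgCl ℓ ≃+* ℂ) (eψ : FramedGaloisRep F ℂ 1), Hyps τ n π e k ℓ eψ → ¬ IsTotallyReal F → ∀ (K : Type) [Field K] [NumberField K] [Algebra F₀ K] [IsCMField K] (cK : K ≃ₐ[F₀]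 K), Module.finrank F₀ K = 2 → cK ≠ 1 → ∀ (L F' : Type) [Field L] [NumberField L] [Field F'] [NumberField F'] [Algebra F₀ L] [Algebra F L] [Algebra K L] [Algebra F' L] [IsScalarTower F₀ F L] [IsScalarTower F₀ K L] [IsGalois K L] (s : L ≃ₐ[F'] L), IsPaneTower τ cK L F' s → ∀ (θ : HeckeCharacter F₀), ParityOut F K θ → (∀ μ : HeckeCharacter F₀, MuHyp F K μ → ∃ (τ' : CuspidalAutomorphicRepData (2 * n) K (isCompact_glFiniteIntegralLevel_holds (2 * n) K)) (ψ₁ : HeckeCharacter K) (P : CuspidalAutomorphicRepData n L (isCompact_glFiniteIntegralLevel_holds n L)) (T : InfinityType K (2 * n)) (χ : (L →+* ℂ) → Multiset ℂ), SatakeOut F₀ π ι eψ cK s τ'.1 ψ₁ P.1 ∧ ArchOut k (θ⁻¹ * μ) τ'.1 ψ₁ T ∧ PaneArchOut n k (θ⁻¹ * μ) P.1 χ) → MemberPkg F₀ π ι eψ K := by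
  intro hex hpin hpane F₀ F _ _ _ _ _ τ n hcpt π e k ℓ _ ι eψ hH hF K _ _ _ _ cK h2 hcK L F' _ _ _ _ _ _
    _ _ _ _ _ s hT θ hpar hobj
  obtain ⟨hTR, hdeg, hτ, -, -, -, -, -, -, -, -, hnti⟩ := id hH
  -- the rank is positive
  have hn : 0 < n := by
    obtain ⟨w, α, β, c, c', hα, hβ, -, -, hne⟩ := hnti.exists
    by_contra h0
    obtain rfl : n = 0 := Nat.eq_zero_of_not_pos h0
    exact hne (by rw [Multiset.card_eq_zero.mp hα.card_eq, Multiset.card_eq_zero.mp hβ.card_eq,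
      Multiset.map_zero, Multiset.map_zero])
  obtain ⟨hFL, hKL, hF'L, hs, hsK, hsF, hdisj, hpaneT⟩ := hT
  obtain ⟨hsplit, μK, μF, hμK, hμF, hμKF, hsgnK, hsgnF⟩ := hpar
  -- signs of `θ` and the complex type
  set d : InfinitePlace F₀ → ℂˣ := fun v ↦ θ.archComponent v (-1) with hd
  have hdsq : ∀ v, d v ^ 2 = 1 := fun v ↦ archComponent_neg_one_sq θ v
  set cx : InfinitePlace F₀ → Prop := fun v ↦ ∃ σ : L →+* ℂ,
    ¬ ComplexEmbedding.IsReal (σ.comp (algebraMap F L)) ∧ InfinitePlace.mk (σ.comp (algebraMap F₀ L)) = v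
    with hcx
  have hθinv : ∀ (μ : HeckeCharacter F₀) (v : InfinitePlace F₀),
      (θ⁻¹ * μ).archComponent v (-1) = (d v)⁻¹ * μ.archComponent v (-1) := fun μ v ↦ by
    rw [archComponent_mul_apply, archComponent_inv_apply]
  -- §A the pin for `μ = 1`: `d` is constant on the complex type
  obtain ⟨τ₁, ψ₁₁, P₁, T₁, χ₁, ⟨-, -, hP₁csd, -⟩, -, hχ₁, hpane₁⟩ := hobj 1 (muHyp_one F K)
  obtain ⟨κ, hκ⟩ := hex F' L s hF'L hs n _ P₁ hn hP₁csd
  have hcxval : ∀ v, cx v → ((d v : ℂˣ) : ℂ) = (((κ : ℤ) : ℂ) * (-1 : ℂ) ^ (-k))⁻¹ := by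
    rintro v ⟨σ, hσF, rfl⟩
    obtain ⟨hnodup, hcard, m, hm, hcoset⟩ := hpane₁ σ
    -- an exponent at the pane
    obtain ⟨a, ha⟩ : ∃ a, a ∈ χ₁ σ := Multiset.card_pos_iff_exists_mem.mp (hcard ▸ hn)
    obtain ⟨j, hj⟩ := hcoset a ha
    -- the pin with `r = (n-1)/2 + (m+k)/2`
    have hcoset' : ∀ b ∈ χ₁ σ, ∃ m' : ℤ, b = (m' : ℂ) + (((((n : ℝ) - 1) / 2 + ((m : ℝ) + k) / 2 : ℝ)) : ℂ) := by
      intro b hb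
      obtain ⟨j', hj'⟩ := hcoset b hb
      exact ⟨j', by rw [hj']; push_cast; ring⟩
    obtain ⟨j', hj'⟩ := hpin F' L s hF'L hs n _ P₁ κ χ₁ σ _ hn hP₁csd hκ hχ₁ (hpaneT σ hσF) hnodup hcoset' a ha
    have hpinned := neg_one_zpow_eq_of_pin (hj.symm.trans hj')
    -- `(θ⁻¹)_v(-1) = (-1)^m` and `(-1)^(m+k) = κ`
    have hm' : ((d (InfinitePlace.mk (σ.comp (algebraMap F₀ L))) : ℂˣ) : ℂ)⁻¹ = (-1 : ℂ) ^ m := by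
      rw [mul_one, archComponent_inv_apply, Units.val_inv_eq_inv_val] at hm
      exact hm
    have hkm : (-1 : ℂ) ^ m = ((κ : ℤ) : ℂ) * (-1 : ℂ) ^ (-k) := by
      rw [← hpinned, ← zpow_add₀ (by norm_num : (-1 : ℂ) ≠ 0), add_neg_cancel_right]
    rw [← hkm, ← hm', inv_inv]
  -- §B constancy on both types, and the switch
  have hcxc : ∀ v v', cx v → cx v' → d v = d v' := fun v v' hv hv' ↦
    Units.ext ((hcxval v hv).trans (hcxval v' hv').symm)
  have hspc : ∀ v v', ¬ cx v → ¬ cx v' → d v = d v' := by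
    intro v v' hv hv'
    obtain ⟨w, hw, rfl⟩ := exists_isReal_of_not_cx v hv
    obtain ⟨w', hw', rfl⟩ := exists_isReal_of_not_cx v' hv'
    exact hsplit w w' hw hw'
  obtain ⟨ε₀, c, hε₀, hsw⟩ : ∃ ε₀ c : ℂˣ, ε₀ ^ 2 = 1 ∧ ∀ v, (if cx v then ε₀ * d v else d v) = c := by
    by_cases hs' : ∃ v₀, ¬ cx v₀
    · obtain ⟨v₀, hv₀⟩ := hs'
      by_cases hc' : ∃ v₁, cx v₁
      · obtain ⟨v₁, hv₁⟩ := hc'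
        refine ⟨d v₀ * (d v₁)⁻¹, d v₀, ?_, fun v ↦ ?_⟩
        · rw [mul_pow, inv_pow, hdsq, hdsq, inv_one, one_mul]
        · split_ifs with h
          · rw [hcxc v v₁ h hv₁, inv_mul_cancel_right]
          · exact hspc v v₀ h hv₀
      · push Not at hc'
        exact ⟨1, d v₀, one_pow 2, fun v ↦ by rw [if_neg (hc' v)]; exact hspc v v₀ (hc' v) hv₀⟩
    · push Not at hs'
      obtain ⟨v₁⟩ : Nonempty (InfinitePlace F₀) := inferInstance
      exact ⟨1, d v₁, one_pow 2, fun v ↦ by rw [if_pos (hs' v), one_mul]; exact hcxc v v₁ (hs' v) (hs' v₁)⟩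
  -- §C the choice of `μ ∈ {1, μK, μF, μK μF}`
  set t : ℂˣ := (-1 : ℂˣ) ^ ((n : ℤ) + k) with ht
  have htval : ((t : ℂˣ) : ℂ) = (-1 : ℂ) ^ ((n : ℤ) + k) := by
    rw [ht, Units.val_zpow_eq_zpow_val, Units.val_neg, Units.val_one]
  have htsq : ((t : ℂˣ) : ℂ) ^ 2 = 1 := by
    rw [htval, ← zpow_natCast, ← zpow_mul, mul_comm, zpow_mul]
    norm_num
  have hcsq : ((c : ℂˣ) : ℂ) ^ 2 = 1 := by
    obtain ⟨v₁⟩ : Nonempty (InfinitePlace F₀) := inferInstance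
    rw [← Units.val_pow_eq_pow_val, ← hsw v₁]
    split_ifs
    · rw [mul_pow, hε₀, hdsq, one_mul, Units.val_one]
    · rw [hdsq, Units.val_one]
  set A : ℂˣ := t * c with hA
  have hAsq : A ^ 2 = 1 :=
    Units.ext (by rw [Units.val_pow_eq_pow_val, hA, Units.val_mul, mul_pow, htsq, hcsq, one_mul, Units.val_one])
  set μA : HeckeCharacter F₀ := if A = 1 then 1 else μK with hμAdef
  set μB : HeckeCharacter F₀ := if ε₀ = 1 then 1 else μF with hμBdef
  have hμA : ∀ v, μA.archComponent v (-1) = A := by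
    intro v
    by_cases h1 : A = 1
    · rw [hμAdef, if_pos h1, h1, HeckeCharacter.archComponent_one, MonoidHom.one_apply]
    · rcases units_eq_or_of_sq hAsq with h | h
      · exact absurd h h1
      · rw [hμAdef, if_neg h1, hsgnK v, h]
  have hμBcx : ∀ v, cx v → μB.archComponent v (-1) = ε₀ := by
    rintro v ⟨σ, hσF, rfl⟩
    by_cases h1 : ε₀ = 1
    · rw [hμBdef, if_pos h1, h1, HeckeCharacter.archComponent_one, MonoidHom.one_apply]
    · rcases units_eq_or_of_sq hε₀ with h | h
      · exact absurd h h1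
      rw [hμBdef, if_neg h1, h]
      have hw := hsgnF (InfinitePlace.mk (σ.comp (algebraMap F L)))
      rw [if_neg (not_isReal_mk_of_cx hσF), InfinitePlace.comap_mk, RingHom.comp_assoc,
        ← IsScalarTower.algebraMap_eq F₀ F L] at hw
      exact hw
  have hμBsp : ∀ v, ¬ cx v → μB.archComponent v (-1) = 1 := by
    intro v hv
    by_cases h1 : ε₀ = 1
    · rw [hμBdef, if_pos h1, HeckeCharacter.archComponent_one, MonoidHom.one_apply]
    · rw [hμBdef, if_neg h1]
      obtain ⟨w, hw, rfl⟩ := exists_isReal_of_not_cx v hv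
      rw [hsgnF w, if_pos hw]
  have hμ : MuHyp F K (μA * μB) := by
    by_cases h1 : A = 1 <;> by_cases h1' : ε₀ = 1 <;>
      simp only [hμAdef, hμBdef, h1, h1', ↓reduceIte, one_mul, mul_one]
    exacts [muHyp_one F K, hμF, hμK, hμKF]
  -- the sign identity at every real place
  have hkey : ∀ v : InfinitePlace F₀,
      (((θ⁻¹ * (μA * μB)).archComponent v (-1) : ℂˣ) : ℂ) = (-1 : ℂ) ^ ((n : ℤ) + k) := by
    intro v
    rw [← htval, hθinv, archComponent_mul_apply, hμA, Units.val_mul, Units.val_mul,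
      Units.val_inv_eq_inv_val, hA, Units.val_mul]
    have hv := hsw v
    have hdv : ((d v : ℂˣ) : ℂ) ^ 2 = 1 := by rw [← Units.val_pow_eq_pow_val, hdsq, Units.val_one]
    have hdv0 : ((d v : ℂˣ) : ℂ) ≠ 0 := Units.ne_zero _
    by_cases h : cx v
    · rw [if_pos h] at hv
      rw [hμBcx v h]
      have hv' : ((ε₀ : ℂˣ) : ℂ) * (d v : ℂ) = c := by rw [← Units.val_mul, hv]
      have he : ((ε₀ : ℂˣ) : ℂ) ^ 2 = 1 := by rw [← Units.val_pow_eq_pow_val, hε₀, Units.val_one]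
      rw [← hv']
      calc ((d v : ℂˣ) : ℂ)⁻¹ * ((t : ℂ) * (((ε₀ : ℂˣ) : ℂ) * (d v : ℂ)) * ((ε₀ : ℂˣ) : ℂ))
          = (t : ℂ) * (((ε₀ : ℂˣ) : ℂ) ^ 2) * (((d v : ℂˣ) : ℂ)⁻¹ * (d v : ℂ)) := by ring
        _ = (t : ℂ) := by rw [he, inv_mul_cancel₀ hdv0, mul_one, mul_one]
    · rw [if_neg h] at hv
      rw [hμBsp v h, ← hv, Units.val_one, mul_one]
      calc ((d v : ℂˣ) : ℂ)⁻¹ * ((t : ℂ) * (d v : ℂ))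
          = (t : ℂ) * (((d v : ℂˣ) : ℂ)⁻¹ * (d v : ℂ)) := by ring
        _ = (t : ℂ) := by rw [inv_mul_cancel₀ hdv0, mul_one]
  -- §D the member objects for this `μ`
  obtain ⟨τ', ψ₁, P, T, χ, ⟨hdict, hτcsd, hPcsd, hAI⟩, ⟨hinfty, hWR, hcrit⟩, hχP, hpaneP⟩ :=
    hobj (μA * μB) hμ
  obtain ⟨hCalg, hψalg⟩ := hcrit hkey
  -- §E a pane: an embedding of `L` over a complex place of `F`
  obtain ⟨w₁, hw₁⟩ : ∃ w : InfinitePlace F, ¬ w.IsReal := by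
    by_contra hall
    push Not at hall
    exact hF ⟨hall⟩
  haveI : Algebra.IsAlgebraic F L := Algebra.IsAlgebraic.of_finite F L
  set σ₁ : L →+* ℂ := ComplexEmbedding.lift L w₁.embedding with hσ₁
  have hσ₁F : ¬ ComplexEmbedding.IsReal (σ₁.comp (algebraMap F L)) := by
    rw [hσ₁, ComplexEmbedding.lift_comp_algebraMap]
    rwa [InfinitePlace.not_isReal_iff_isComplex, InfinitePlace.isComplex_iff] at hw₁
  obtain ⟨hnodup, hcard, m₁, hm₁, hcoset₁⟩ := hpaneP σ₁
  have hpar₁ : (-1 : ℂ) ^ m₁ = (-1 : ℂ) ^ ((n : ℤ) + k) := by rw [← hm₁, hkey]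
  have hhalf : ∀ a ∈ χ σ₁, ∃ i : ℤ, a = (i : ℂ) + 1 / 2 := fun a ha ↦ by
    obtain ⟨j, hj⟩ := hcoset₁ a ha
    exact exists_int_add_half_of_neg_one_zpow hpar₁ hj
  -- the pane law at the base `K⁺`
  have hsK' : ∀ x : K, s (algebraMap K L x) = algebraMap K L (IsCMField.complexConj K x) :=
    fun x ↦ by rw [complexConj_apply_eq hTR h2 hcK x]; exact hsK x
  have hτcsd' : τ'.1.IsConjSelfDualAE (IsCMField.complexConj K) :=
    isConjSelfDualAE_of_smul_eq (complexConj_smul_eq hTR h2 hcK) hτcsd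
  have hAsai : τ'.1.HasAsaiSign (IsCMField.complexConj K) 1 :=
    hpane (maximalRealSubfield K) K F' L (IsCMField.complexConj K) s
      (Algebra.IsQuadraticExtension.finrank_eq_two _ K) hKL hF'L (IsCMField.complexConj_ne_one K) hs
      hsK' n _ _ P τ' χ σ₁ hn hAI hPcsd hτcsd' hχP (hpaneT σ₁ hσ₁F) hnodup hcard hhalf
  exact ⟨_, τ', T, ψ₁, hinfty, hCalg, hWR, hτcsd', hAsai, hψalg, hdict⟩

end Main

end Summit.Langlands.Langlands.Theorems.HostInducedRep.OneTransparentPane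

end
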